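import Summits.QuantumFields.QCD.Theses.HeatSlicedQuarks
import Literature.MathematicalPhysics.QuantumLattice.WilsonFermionBlockAveraging
import Mathlib.Analysis.Normed.Algebra.MatrixExponential

/-!
# Stub `stub_coveringPeriodization` of line `Sketch` (crux `InterleavedHeatSliceFlow`, item stmt-QuantumFields-8891)

**Finite covering periodization of the Wilson heat kernel.**  Let `π : T_{NL} → T_L` be the
coordinatewise reduction `(ℤ/NLℤ)⁴ → (ℤ/Lℤ)⁴` of the `N⁴`-sheeted covering of the discrete
four-torus, `U` a lattice gauge field on `T_L` and `U ∘ π` its (deck-periodic) pull-back to `T_{NL}`.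
With `H_V = D_W(V)ᴴ D_W(V)` the square of the Wilson–Dirac operator (`r = 1`) and
`K_V = exp(-t H_V)`, for all sites `x̃ ∈ T_{NL}`, `y ∈ T_L` and internal (colour, spin) indices

  `K_U((π x̃, a, α), (y, b, β)) = Σ_{z̃ : π z̃ = y} K_{U∘π}((x̃, a, α), (z̃, b, β))`.

## Proof

Pure finite-dimensional algebra.  Let `P` be the pull-back matrix
`P (x̃, i) (y, j) = [π x̃ = y] [i = j]` (so `(P M)(p̃, q) = M((π p̃.1, p̃.2), q)` and
`(M̃ P)(p̃, q) = Σ_{z̃ : π z̃ = q.1} M̃(p̃, (z̃, q.2))`, `pull_mul_apply`, `mul_pull_apply`).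

1. *Locality.*  A forward hopping matrix `[q.1 = p.1 + μ̂] A(p.1)` with deck-periodic coefficients
   `A = A₀ ∘ π` satisfies `F̃ P = P F` (`fwdShape_mul_pull`), and likewise a backward hopping matrix
   `[p.1 = q.1 + μ̂] B(q.1)` (`bwdShape_mul_pull`); the only input is `π (x + μ̂) = π x + μ̂`.
   The tree's hopping decomposition `wilsonDirac_eq` (`D_W = (m + 4r)·1 - ½ Σ_μ (H⁺_μ + H⁻_μ)`)
   then gives `D_W(U∘π) P = P D_W(U)`; since the conjugate transpose of a forward hopping matrix is
   a backward one (and vice versa), also `D_W(U∘π)ᴴ P = P D_W(U)ᴴ`, hence `H_{U∘π} P = P H_U`.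
2. *Exponential.*  From `A P = P B` (rectangular `P`) we get `Aⁿ P = P Bⁿ`, and pushing the two
   continuous additive maps `X ↦ X P`, `Y ↦ P Y` through the exponential series
   (`NormedSpace.exp_series_hasSum_exp'`, in the `L^∞` operator norm structure
   `Matrix.Norms.Operator`, whose topology is the product one) gives `exp A · P = P · exp B`
   (`exp_mul_pull_of_mul_pull`).
3. *Evaluation* of `exp(-tH_{U∘π}) P = P exp(-tH_U)` at the entry `((x̃, a, α), (y, b, β))`.

No named facts are used (tree definitions `wilsonDirac`, `wilsonHopFwd`, `wilsonHopBwd`,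
`wilsonDirac_eq`, `Site.shift`; Mathlib otherwise).
-/

namespace Summit.QuantumFields.QCD.Cruxes.InterleavedHeatSliceFlow.Sketch

open Literature.MathematicalPhysics.QuantumLattice Literature.MathematicalPhysics.QuantumFieldTheory
  Literature.Probability.LatticeModels
open Summit.QuantumFields.QCD.Theses.HeatSlicedQuarks
open scoped Matrix Kronecker ComplexConjugate

/-! ### The pull-back matrix of a map of site sets -/

/-- Left multiplication by the pull-back matrix `P (x̃, i) (y, j) = [π x̃ = y] [i = j]` evaluates the
site index through `π`: `(P M)(p̃, q) = M((π p̃.1, p̃.2), q)`. -/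
private theorem pull_mul_apply {X X' κ o : Type*} [Fintype X] [DecidableEq X] [Fintype κ]
    [DecidableEq κ] (π : X' → X) (Y : Matrix (X × κ) o ℂ) (p : X' × κ) (q : o) :
    ((Matrix.of fun (p : X' × κ) (q : X × κ) => if (π p.1, p.2) = q then (1 : ℂ) else 0) * Y) p q =
      Y (π p.1, p.2) q := by
  simp [Matrix.mul_apply]

/-- Right multiplication by the pull-back matrix sums over the fibres of `π`:
`(M P)(p, q) = Σ_{z̃ : π z̃ = q.1} M(p, (z̃, q.2))`. -/
private theorem mul_pull_apply {X X' κ o : Type*} [Fintype X'] [Fintype κ] [DecidableEq X]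
    [DecidableEq κ] (π : X' → X) (Y : Matrix o (X' × κ) ℂ) (p : o) (q : X × κ) :
    (Y * Matrix.of fun (p : X' × κ) (q : X × κ) => if (π p.1, p.2) = q then (1 : ℂ) else 0) p q =
      ∑ z ∈ Finset.univ.filter (fun z => π z = q.1), Y p (z, q.2) := by
  obtain ⟨y, k⟩ := q
  rw [Matrix.mul_apply, Fintype.sum_prod_type, Finset.sum_filter]
  refine Finset.sum_congr rfl fun z _ => ?_
  simp only [Matrix.of_apply, Prod.mk.injEq, mul_ite, mul_one, mul_zero]
  by_cases h : π z = y
  · simp [h]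
  · simp [h]

/-! ### Locality: hopping matrices with deck-periodic coefficients intertwine with the pull-back -/

/-- A forward hopping matrix `[q.1 = p.1 + μ̂] A(π p.1)` on the cover, with coefficients pulled
back from the base, intertwines with the pull-back matrix: `F̃ P = P F`.  Only
`π (x + μ̂) = π x + μ̂` is used. -/
private theorem fwdShape_mul_pull {d L L' : ℕ} [NeZero L] [NeZero L'] {κ : Type*} [Fintype κ]
    [DecidableEq κ] (π : Site d L' → Site d L)
    (hπ : ∀ x μ, π (Site.shift x μ) = Site.shift (π x) μ) (μ : Fin d)
    (A : Site d L → κ → κ → ℂ) :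
    (Matrix.of fun p q : Site d L' × κ =>
          if q.1 = Site.shift p.1 μ then A (π p.1) p.2 q.2 else 0) *
        (Matrix.of fun (p : Site d L' × κ) (q : Site d L × κ) =>
          if (π p.1, p.2) = q then (1 : ℂ) else 0) =
      (Matrix.of fun (p : Site d L' × κ) (q : Site d L × κ) =>
          if (π p.1, p.2) = q then (1 : ℂ) else 0) *
        Matrix.of fun p q : Site d L × κ =>
          if q.1 = Site.shift p.1 μ then A p.1 p.2 q.2 else 0 := by
  ext p q
  rw [mul_pull_apply, pull_mul_apply]
  simp only [Matrix.of_apply]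
  by_cases h : q.1 = Site.shift (π p.1) μ
  · rw [if_pos h, Finset.sum_eq_single_of_mem (Site.shift p.1 μ)]
    · rw [if_pos rfl]
    · rw [Finset.mem_filter, hπ]
      exact ⟨Finset.mem_univ _, h.symm⟩
    · intro z _ hz
      exact if_neg hz
  · rw [if_neg h]
    refine Finset.sum_eq_zero fun z hz => if_neg ?_
    rintro rfl
    rw [Finset.mem_filter, hπ] at hz
    exact h hz.2.symm

/-- A backward hopping matrix `[p.1 = q.1 + μ̂] B(π q.1)` on the cover, with coefficients pulled
back from the base, intertwines with the pull-back matrix: `B̃ P = P B`.  Only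
`π (x + μ̂) = π x + μ̂` (and the bijectivity of `x ↦ x + μ̂`) is used. -/
private theorem bwdShape_mul_pull {d L L' : ℕ} [NeZero L] [NeZero L'] {κ : Type*} [Fintype κ]
    [DecidableEq κ] (π : Site d L' → Site d L)
    (hπ : ∀ x μ, π (Site.shift x μ) = Site.shift (π x) μ) (μ : Fin d)
    (B : Site d L → κ → κ → ℂ) :
    (Matrix.of fun p q : Site d L' × κ =>
          if p.1 = Site.shift q.1 μ then B (π q.1) p.2 q.2 else 0) *
        (Matrix.of fun (p : Site d L' × κ) (q : Site d L × κ) =>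
          if (π p.1, p.2) = q then (1 : ℂ) else 0) =
      (Matrix.of fun (p : Site d L' × κ) (q : Site d L × κ) =>
          if (π p.1, p.2) = q then (1 : ℂ) else 0) *
        Matrix.of fun p q : Site d L × κ =>
          if p.1 = Site.shift q.1 μ then B q.1 p.2 q.2 else 0 := by
  ext p q
  rw [mul_pull_apply, pull_mul_apply]
  simp only [Matrix.of_apply]
  -- the unique backward neighbour `p.1 - μ̂` of `p.1` on the cover and its image
  have hback : Site.shift (p.1 - Pi.single μ 1) μ = p.1 := sub_add_cancel _ _
  have hπback : Site.shift (π (p.1 - Pi.single μ 1)) μ = π p.1 := by rw [← hπ, hback]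
  by_cases h : π p.1 = Site.shift q.1 μ
  · have hq : π (p.1 - Pi.single μ 1) = q.1 :=
      add_right_cancel (hπback.trans h : _ = Site.shift q.1 μ)
    rw [if_pos h, Finset.sum_eq_single_of_mem (p.1 - Pi.single μ 1)]
    · rw [if_pos hback.symm, hq]
    · rw [Finset.mem_filter]
      exact ⟨Finset.mem_univ _, hq⟩
    · intro z _ hz
      refine if_neg fun hz' => hz ?_
      rw [hz', Literature.MathematicalPhysics.QuantumFieldTheory.Site.shift, add_sub_cancel_right]
  · rw [if_neg h]
    refine Finset.sum_eq_zero fun z hz => if_neg fun hz' => h ?_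
    rw [Finset.mem_filter] at hz
    rw [← hz.2, ← hπ, ← hz']

/-- Conjugate transpose of a forward hopping matrix is a backward one. -/
private theorem conjTranspose_fwdShape {d L : ℕ} {κ : Type*} (μ : Fin d)
    (A : Site d L → κ → κ → ℂ) :
    (Matrix.of fun p q : Site d L × κ => if q.1 = Site.shift p.1 μ then A p.1 p.2 q.2 else 0)ᴴ =
      Matrix.of fun p q : Site d L × κ =>
        if p.1 = Site.shift q.1 μ then star (A q.1 q.2 p.2) else 0 := by
  ext p q
  simp only [Matrix.conjTranspose_apply, Matrix.of_apply]
  split_ifs <;> simp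

/-- Conjugate transpose of a backward hopping matrix is a forward one. -/
private theorem conjTranspose_bwdShape {d L : ℕ} {κ : Type*} (μ : Fin d)
    (B : Site d L → κ → κ → ℂ) :
    (Matrix.of fun p q : Site d L × κ => if p.1 = Site.shift q.1 μ then B q.1 p.2 q.2 else 0)ᴴ =
      Matrix.of fun p q : Site d L × κ =>
        if q.1 = Site.shift p.1 μ then star (B p.1 q.2 p.2) else 0 := by
  ext p q
  simp only [Matrix.conjTranspose_apply, Matrix.of_apply]
  split_ifs <;> simp

/-! ### The Wilson–Dirac operator of a pulled-back configuration -/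

section Wilson

variable {L L' N : ℕ} [NeZero L] [NeZero L'] {G : Type*} [Group G]
  (ρ : G →* Matrix (Fin N) (Fin N) ℂ) (π : TorusSite 4 L' → TorusSite 4 L)
  (hπ : ∀ x μ, π (Site.shift x μ) = Site.shift (π x) μ) (U : GaugeConfig 4 L G)

include hπ

/-- `H⁺_μ(U ∘ π) P = P H⁺_μ(U)`. -/
private theorem wilsonHopFwd_mul_pull (r : ℝ) (μ : Fin 4) :
    wilsonHopFwd ρ (fun e : Edge 4 L' => U (π e.1, e.2)) r μ *
        (Matrix.of fun (p : TorusSite 4 L' × Fin N × Fin 4) (q : TorusSite 4 L × Fin N × Fin 4) =>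
          if (π p.1, p.2) = q then (1 : ℂ) else 0) =
      (Matrix.of fun (p : TorusSite 4 L' × Fin N × Fin 4) (q : TorusSite 4 L × Fin N × Fin 4) =>
          if (π p.1, p.2) = q then (1 : ℂ) else 0) *
        wilsonHopFwd ρ U r μ := by
  set A : TorusSite 4 L → Fin N × Fin 4 → Fin N × Fin 4 → ℂ := fun x i j =>
    ((r : ℂ) • (1 : Matrix (Fin 4) (Fin 4) ℂ) - euclideanGamma μ) i.2 j.2 * ρ (U (x, μ)) i.1 j.1
  have e1 : wilsonHopFwd ρ (fun e : Edge 4 L' => U (π e.1, e.2)) r μ =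
      Matrix.of fun p q : TorusSite 4 L' × Fin N × Fin 4 =>
        if q.1 = Site.shift p.1 μ then A (π p.1) p.2 q.2 else 0 := rfl
  have e2 : wilsonHopFwd ρ U r μ =
      Matrix.of fun p q : TorusSite 4 L × Fin N × Fin 4 =>
        if q.1 = Site.shift p.1 μ then A p.1 p.2 q.2 else 0 := rfl
  rw [e1, e2]
  exact fwdShape_mul_pull π hπ μ A

/-- `H⁻_μ(U ∘ π) P = P H⁻_μ(U)`. -/
private theorem wilsonHopBwd_mul_pull (r : ℝ) (μ : Fin 4) :
    wilsonHopBwd ρ (fun e : Edge 4 L' => U (π e.1, e.2)) r μ *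
        (Matrix.of fun (p : TorusSite 4 L' × Fin N × Fin 4) (q : TorusSite 4 L × Fin N × Fin 4) =>
          if (π p.1, p.2) = q then (1 : ℂ) else 0) =
      (Matrix.of fun (p : TorusSite 4 L' × Fin N × Fin 4) (q : TorusSite 4 L × Fin N × Fin 4) =>
          if (π p.1, p.2) = q then (1 : ℂ) else 0) *
        wilsonHopBwd ρ U r μ := by
  set B : TorusSite 4 L → Fin N × Fin 4 → Fin N × Fin 4 → ℂ := fun y i j =>
    ((r : ℂ) • (1 : Matrix (Fin 4) (Fin 4) ℂ) + euclideanGamma μ) i.2 j.2 * ρ (U (y, μ))⁻¹ i.1 j.1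
  have e1 : wilsonHopBwd ρ (fun e : Edge 4 L' => U (π e.1, e.2)) r μ =
      Matrix.of fun p q : TorusSite 4 L' × Fin N × Fin 4 =>
        if p.1 = Site.shift q.1 μ then B (π q.1) p.2 q.2 else 0 := rfl
  have e2 : wilsonHopBwd ρ U r μ =
      Matrix.of fun p q : TorusSite 4 L × Fin N × Fin 4 =>
        if p.1 = Site.shift q.1 μ then B q.1 p.2 q.2 else 0 := rfl
  rw [e1, e2]
  exact bwdShape_mul_pull π hπ μ B

/-- `H⁺_μ(U ∘ π)ᴴ P = P H⁺_μ(U)ᴴ`. -/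
private theorem wilsonHopFwd_conjTranspose_mul_pull (r : ℝ) (μ : Fin 4) :
    (wilsonHopFwd ρ (fun e : Edge 4 L' => U (π e.1, e.2)) r μ)ᴴ *
        (Matrix.of fun (p : TorusSite 4 L' × Fin N × Fin 4) (q : TorusSite 4 L × Fin N × Fin 4) =>
          if (π p.1, p.2) = q then (1 : ℂ) else 0) =
      (Matrix.of fun (p : TorusSite 4 L' × Fin N × Fin 4) (q : TorusSite 4 L × Fin N × Fin 4) =>
          if (π p.1, p.2) = q then (1 : ℂ) else 0) *
        (wilsonHopFwd ρ U r μ)ᴴ := by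
  set A : TorusSite 4 L → Fin N × Fin 4 → Fin N × Fin 4 → ℂ := fun x i j =>
    ((r : ℂ) • (1 : Matrix (Fin 4) (Fin 4) ℂ) - euclideanGamma μ) i.2 j.2 * ρ (U (x, μ)) i.1 j.1
  have e1 : (wilsonHopFwd ρ (fun e : Edge 4 L' => U (π e.1, e.2)) r μ)ᴴ =
      Matrix.of fun p q : TorusSite 4 L' × Fin N × Fin 4 =>
        if p.1 = Site.shift q.1 μ then star (A (π q.1) q.2 p.2) else 0 :=
    conjTranspose_fwdShape μ fun x i j => A (π x) i j
  have e2 : (wilsonHopFwd ρ U r μ)ᴴ =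
      Matrix.of fun p q : TorusSite 4 L × Fin N × Fin 4 =>
        if p.1 = Site.shift q.1 μ then star (A q.1 q.2 p.2) else 0 :=
    conjTranspose_fwdShape μ A
  rw [e1, e2]
  exact bwdShape_mul_pull π hπ μ fun y i j => star (A y j i)

/-- `H⁻_μ(U ∘ π)ᴴ P = P H⁻_μ(U)ᴴ`. -/
private theorem wilsonHopBwd_conjTranspose_mul_pull (r : ℝ) (μ : Fin 4) :
    (wilsonHopBwd ρ (fun e : Edge 4 L' => U (π e.1, e.2)) r μ)ᴴ *
        (Matrix.of fun (p : TorusSite 4 L' × Fin N × Fin 4) (q : TorusSite 4 L × Fin N × Fin 4) =>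
          if (π p.1, p.2) = q then (1 : ℂ) else 0) =
      (Matrix.of fun (p : TorusSite 4 L' × Fin N × Fin 4) (q : TorusSite 4 L × Fin N × Fin 4) =>
          if (π p.1, p.2) = q then (1 : ℂ) else 0) *
        (wilsonHopBwd ρ U r μ)ᴴ := by
  set B : TorusSite 4 L → Fin N × Fin 4 → Fin N × Fin 4 → ℂ := fun y i j =>
    ((r : ℂ) • (1 : Matrix (Fin 4) (Fin 4) ℂ) + euclideanGamma μ) i.2 j.2 * ρ (U (y, μ))⁻¹ i.1 j.1
  have e1 : (wilsonHopBwd ρ (fun e : Edge 4 L' => U (π e.1, e.2)) r μ)ᴴ =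
      Matrix.of fun p q : TorusSite 4 L' × Fin N × Fin 4 =>
        if q.1 = Site.shift p.1 μ then star (B (π p.1) q.2 p.2) else 0 :=
    conjTranspose_bwdShape μ fun y i j => B (π y) i j
  have e2 : (wilsonHopBwd ρ U r μ)ᴴ =
      Matrix.of fun p q : TorusSite 4 L × Fin N × Fin 4 =>
        if q.1 = Site.shift p.1 μ then star (B p.1 q.2 p.2) else 0 :=
    conjTranspose_bwdShape μ B
  rw [e1, e2]
  exact fwdShape_mul_pull π hπ μ fun x i j => star (B x j i)

/-- **Locality**: the Wilson–Dirac operator of the pulled-back configuration intertwines with the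
pull-back matrix, `D_W(U ∘ π) P = P D_W(U)`. -/
private theorem wilsonDirac_mul_pull (m r : ℝ) :
    wilsonDirac ρ (fun e : Edge 4 L' => U (π e.1, e.2)) m r *
        (Matrix.of fun (p : TorusSite 4 L' × Fin N × Fin 4) (q : TorusSite 4 L × Fin N × Fin 4) =>
          if (π p.1, p.2) = q then (1 : ℂ) else 0) =
      (Matrix.of fun (p : TorusSite 4 L' × Fin N × Fin 4) (q : TorusSite 4 L × Fin N × Fin 4) =>
          if (π p.1, p.2) = q then (1 : ℂ) else 0) *
        wilsonDirac ρ U m r := by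
  rw [wilsonDirac_eq, wilsonDirac_eq]
  simp only [Matrix.sub_mul, Matrix.mul_sub, Matrix.smul_mul, Matrix.mul_smul, Matrix.one_mul,
    Matrix.mul_one, Matrix.sum_mul, Matrix.mul_sum, Matrix.add_mul, Matrix.mul_add,
    wilsonHopFwd_mul_pull ρ π hπ U, wilsonHopBwd_mul_pull ρ π hπ U]

/-- **Locality, adjoint**: `D_W(U ∘ π)ᴴ P = P D_W(U)ᴴ`. -/
private theorem wilsonDirac_conjTranspose_mul_pull (m r : ℝ) :
    (wilsonDirac ρ (fun e : Edge 4 L' => U (π e.1, e.2)) m r)ᴴ *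
        (Matrix.of fun (p : TorusSite 4 L' × Fin N × Fin 4) (q : TorusSite 4 L × Fin N × Fin 4) =>
          if (π p.1, p.2) = q then (1 : ℂ) else 0) =
      (Matrix.of fun (p : TorusSite 4 L' × Fin N × Fin 4) (q : TorusSite 4 L × Fin N × Fin 4) =>
          if (π p.1, p.2) = q then (1 : ℂ) else 0) *
        (wilsonDirac ρ U m r)ᴴ := by
  rw [wilsonDirac_eq, wilsonDirac_eq]
  simp only [Matrix.conjTranspose_sub, Matrix.conjTranspose_smul, Matrix.conjTranspose_one,
    Matrix.conjTranspose_sum, Matrix.conjTranspose_add, Matrix.sub_mul, Matrix.mul_sub,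
    Matrix.smul_mul, Matrix.mul_smul, Matrix.one_mul, Matrix.mul_one, Matrix.sum_mul,
    Matrix.mul_sum, Matrix.add_mul, Matrix.mul_add, wilsonHopFwd_conjTranspose_mul_pull ρ π hπ U,
    wilsonHopBwd_conjTranspose_mul_pull ρ π hπ U]

/-- `H_{U∘π} P = P H_U` for `H_V = D_W(V)ᴴ D_W(V)`. -/
private theorem wilsonSq_mul_pull (m r : ℝ) :
    (wilsonDirac ρ (fun e : Edge 4 L' => U (π e.1, e.2)) m r)ᴴ *
          wilsonDirac ρ (fun e : Edge 4 L' => U (π e.1, e.2)) m r *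
        (Matrix.of fun (p : TorusSite 4 L' × Fin N × Fin 4) (q : TorusSite 4 L × Fin N × Fin 4) =>
          if (π p.1, p.2) = q then (1 : ℂ) else 0) =
      (Matrix.of fun (p : TorusSite 4 L' × Fin N × Fin 4) (q : TorusSite 4 L × Fin N × Fin 4) =>
          if (π p.1, p.2) = q then (1 : ℂ) else 0) *
        ((wilsonDirac ρ U m r)ᴴ * wilsonDirac ρ U m r) := by
  rw [Matrix.mul_assoc, wilsonDirac_mul_pull ρ π hπ U, ← Matrix.mul_assoc,
    wilsonDirac_conjTranspose_mul_pull ρ π hπ U, Matrix.mul_assoc]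

end Wilson

/-! ### Intertwining passes to the exponential -/

/-- If a rectangular matrix `P` intertwines two square matrices, `A P = P B`, then it intertwines
their exponentials: `exp A · P = P · exp B` (push `X ↦ X P` and `Y ↦ P Y` through the exponential
series and use `Aⁿ P = P Bⁿ`). -/
private theorem exp_mul_pull_of_mul_pull {m n : Type*} [Fintype m] [DecidableEq m] [Fintype n]
    [DecidableEq n] (A : Matrix m m ℂ) (B : Matrix n n ℂ) (P : Matrix m n ℂ) (h : A * P = P * B) :
    NormedSpace.exp A * P = P * NormedSpace.exp B := by
  have hpow : ∀ k : ℕ, A ^ k * P = P * B ^ k := fun k => by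
    induction k with
    | zero => rw [pow_zero, pow_zero, Matrix.one_mul, Matrix.mul_one]
    | succ k ih =>
      rw [pow_succ, Matrix.mul_assoc, h, ← Matrix.mul_assoc, ih, Matrix.mul_assoc, ← pow_succ]
  let f : Matrix m m ℂ →+ Matrix m n ℂ := AddMonoidHom.mk' (fun X => X * P) fun X Y =>
    Matrix.add_mul X Y P
  let g : Matrix n n ℂ →+ Matrix m n ℂ := AddMonoidHom.mk' (fun Y => P * Y) fun X Y =>
    Matrix.mul_add P X Y
  have hf : Continuous f := continuous_id.matrix_mul continuous_const
  have hg : Continuous g := continuous_const.matrix_mul continuous_id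
  open scoped Matrix.Norms.Operator in
  have hA : HasSum (f ∘ fun k : ℕ => (k.factorial⁻¹ : ℂ) • A ^ k) (f (NormedSpace.exp A)) :=
    (NormedSpace.exp_series_hasSum_exp' (𝕂 := ℂ) A).map f hf
  open scoped Matrix.Norms.Operator in
  have hB : HasSum (g ∘ fun k : ℕ => (k.factorial⁻¹ : ℂ) • B ^ k) (g (NormedSpace.exp B)) :=
    (NormedSpace.exp_series_hasSum_exp' (𝕂 := ℂ) B).map g hg
  have hfg : (f ∘ fun k : ℕ => (k.factorial⁻¹ : ℂ) • A ^ k) =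
      (g ∘ fun k : ℕ => (k.factorial⁻¹ : ℂ) • B ^ k) := by
    funext k
    simp only [Function.comp_apply, f, g, AddMonoidHom.mk'_apply, Matrix.smul_mul, Matrix.mul_smul,
      hpow]
  rw [hfg] at hA
  exact hA.unique hB

/-! ### The covering map -/

/-- The coordinatewise reduction `π : (ℤ/NLℤ)⁴ → (ℤ/Lℤ)⁴` commutes with the unit shifts:
`π (x + μ̂) = π x + μ̂`. -/
private theorem castHom_shift (N L : ℕ) (x : TorusSite 4 (N * L)) (μ : Fin 4) :
    (fun ν => ZMod.castHom (dvd_mul_left L N) (ZMod L) (Site.shift x μ ν)) =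
      Site.shift (fun ν => ZMod.castHom (dvd_mul_left L N) (ZMod L) (x ν)) μ := by
  funext ν
  simp only [Literature.MathematicalPhysics.QuantumFieldTheory.Site.shift, Pi.add_apply, map_add,
    Pi.single_apply]
  split_ifs <;> simp

/-- The periodization identity for a general map of site sets `π : T_{L'} → T_L` commuting with the
unit shifts: `K_U((π x̃, a, α), (y, b, β)) = Σ_{z̃ : π z̃ = y} K_{U∘π}((x̃, a, α), (z̃, b, β))`. -/
private theorem periodization {L L' : ℕ} [NeZero L] [NeZero L']
    (π : TorusSite 4 L' → TorusSite 4 L) (hπ : ∀ x μ, π (Site.shift x μ) = Site.shift (π x) μ)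
    (U : GaugeConfig 4 L (Matrix.specialUnitaryGroup (Fin 3) ℂ)) (m t : ℝ)
    (x : TorusSite 4 L') (y : TorusSite 4 L) (a b : Fin 3) (α β : Fin 4) :
    (NormedSpace.exp (-(t : ℂ) • ((wilsonDirac (fundamentalRep (Fin 3)) U m 1)ᴴ *
          wilsonDirac (fundamentalRep (Fin 3)) U m 1))) (π x, a, α) (y, b, β) =
      ∑ z ∈ Finset.univ.filter (fun z : TorusSite 4 L' => π z = y),
        (NormedSpace.exp (-(t : ℂ) •
          ((wilsonDirac (fundamentalRep (Fin 3)) (fun e : Edge 4 L' => U (π e.1, e.2)) m 1)ᴴ *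
            wilsonDirac (fundamentalRep (Fin 3)) (fun e : Edge 4 L' => U (π e.1, e.2)) m 1)))
          (x, a, α) (z, b, β) := by
  set P : Matrix (TorusSite 4 L' × Fin 3 × Fin 4) (TorusSite 4 L × Fin 3 × Fin 4) ℂ :=
    Matrix.of fun p q => if (π p.1, p.2) = q then (1 : ℂ) else 0 with hP
  set H := (wilsonDirac (fundamentalRep (Fin 3)) U m 1)ᴴ * wilsonDirac (fundamentalRep (Fin 3)) U m 1
    with hH
  set H' := (wilsonDirac (fundamentalRep (Fin 3)) (fun e : Edge 4 L' => U (π e.1, e.2)) m 1)ᴴ *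
      wilsonDirac (fundamentalRep (Fin 3)) (fun e : Edge 4 L' => U (π e.1, e.2)) m 1 with hH'
  have hHP : H' * P = P * H := wilsonSq_mul_pull (fundamentalRep (Fin 3)) π hπ U m 1
  have htHP : (-(t : ℂ) • H') * P = P * (-(t : ℂ) • H) := by
    rw [Matrix.smul_mul, Matrix.mul_smul, hHP]
  have hexp := exp_mul_pull_of_mul_pull _ _ P htHP
  calc (NormedSpace.exp (-(t : ℂ) • H)) (π x, a, α) (y, b, β)
      = (P * NormedSpace.exp (-(t : ℂ) • H)) (x, a, α) (y, b, β) :=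
        (pull_mul_apply π _ (x, a, α) (y, b, β)).symm
    _ = (NormedSpace.exp (-(t : ℂ) • H') * P) (x, a, α) (y, b, β) := by rw [hexp]
    _ = _ := mul_pull_apply π _ (x, a, α) (y, b, β)

/-- **Stub `stub_coveringPeriodization`** (M/L; reshape r3; worker): `CoveringPeriodization` written out.
Finite covering periodization of the Wilson heat kernel: with `π : T_{NL} → T_L` the coordinatewise
reduction, `K_U((π x̃, a, α), (y, b, β)) = Σ_{z̃ : π z̃ = y} K_{U∘π}((x̃, a, α), (z̃, b, β))` for
`K_V = exp(-t D_W(V)ᴴ D_W(V))`.  Proof: the pull-back matrix `P` intertwines `D_W`, `D_Wᴴ` (locality of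
the hopping terms and `π (x + μ̂) = π x + μ̂`), hence `H` and `exp(-tH)` (exponential series); then
evaluate `exp(-tH_{U∘π}) P = P exp(-tH_U)` at one entry.  Leans on: `wilsonDirac`, `wilsonDirac_eq`,
`Site.shift`, `ZMod.castHom`; Mathlib only beyond the tree's definitions. -/
theorem stub_coveringPeriodization :
    ∀ (N L : ℕ) [NeZero L] [NeZero (N * L)]
      (U : GaugeConfig 4 L (Matrix.specialUnitaryGroup (Fin 3) ℂ)) (m t : ℝ)
      (x : TorusSite 4 (N * L)) (y : TorusSite 4 L) (a b : Fin 3) (α β : Fin 4),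
      (NormedSpace.exp (-(t : ℂ) • ((wilsonDirac (fundamentalRep (Fin 3)) U m 1)ᴴ *
            wilsonDirac (fundamentalRep (Fin 3)) U m 1)))
          ((fun μ => ZMod.castHom (dvd_mul_left L N) (ZMod L) (x μ)), a, α) (y, b, β) =
        ∑ z ∈ Finset.univ.filter
            (fun z : TorusSite 4 (N * L) => (fun μ => ZMod.castHom (dvd_mul_left L N) (ZMod L) (z μ)) = y),
          (NormedSpace.exp (-(t : ℂ) •
            ((wilsonDirac (fundamentalRep (Fin 3))
                (fun e : Edge 4 (N * L) => U ((fun μ => ZMod.castHom (dvd_mul_left L N) (ZMod L) (e.1 μ)), e.2)) m 1)ᴴ *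
              wilsonDirac (fundamentalRep (Fin 3))
                (fun e : Edge 4 (N * L) => U ((fun μ => ZMod.castHom (dvd_mul_left L N) (ZMod L) (e.1 μ)), e.2)) m 1)))
            (x, a, α) (z, b, β) := by
  intro N L _ _ U m t x y a b α β
  exact periodization (fun (z : TorusSite 4 (N * L)) μ => ZMod.castHom (dvd_mul_left L N) (ZMod L) (z μ))
    (castHom_shift N L) U m t x y a b α β

end Summit.QuantumFields.QCD.Cruxes.InterleavedHeatSliceFlow.Sketch
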